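import Literature.AlgebraicGeometry.HodgeTheory.BettiKunnethPieceHodgeClassesHomIntegerTwist
import Literature.AlgebraicGeometry.HodgeTheory.BettiKunnethPiecesHardLefschetzReduction
import Literature.AlgebraicGeometry.HodgeTheory.ProductFactorsHodgeDescent
import HarnessLib

/-!
# `HC(Y × Z)` for ALL smooth projective `Y` (`dim m`), `Z` (`dim n`): `HC(Y × Z)` ⟺ `HC(Y)`, `HC(Z)` and, for every WINDOW piece `1 ≤ i ≤ m`, `1 ≤ j ≤ n`, `i + j = 2c ≥ 4`, every morphism of `ℚ`-Hodge
# structures `φ : H^{2n−j}(Z) → Hⁱ(Y)(c − n)` is induced by an algebraic class LYING IN THE PIECE `Hⁱ(Y) ⊗ Hʲ(Z)` — i.e. the class `t_φ` of Lemma 11.41 has `crossMap t_φ ⊗ 1` algebraic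
# (Voisin I §11.3.3 Thm. 11.38–11.40, Lemma 11.41, pp. 285–287; §6.2.3 Thm. 6.25; §7.3.1 Def. 7.22, §7.3.2 Lemma 7.28; Thm. 11.30; Voisin II Prop. 9.20; Voisin 2025 §3.2.1; Arapura Lemma 4.2)

Family `hodge`, lane `lit-hodgefound` (Track 2 foundations library; Layers A1/A4), layer `Literature/AlgebraicGeometry/HodgeTheory`.  THEOREMS ONLY (no definition, no named fact, no instance;
D-0026 net debt `0`).  The ISOLATED companion of the seat's g31-#10 (the joint window criterion).  The tree's assembly `BettiUniverse.hodgeConjectureFor_tensor_of_kunneth_pieces_pos_le` gives `HC(Y × Z)`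
from `HC(Y)`, `HC(Z)` and the algebraicity of `crossMap t` for the Hodge classes `t` of the window pieces `Hⁱ(Y) ⊗ Hʲ(Z)`, `1 ≤ i ≤ m`, `1 ≤ j ≤ n`, `2 ≤ c`; the converse is immediate (`crossMap t` is a
Hodge class of `H^{2c}(Y × Z)`, Thm. 11.40), so this per-piece criterion is an EQUIVALENCE (§1).  By Lemma 11.41 with integer twists (g31-#2: the Hodge classes `t` of `Hⁱ(Y) ⊗ Hʲ(Z) ⊂ H^{2c}` are
exactly the morphisms of Hodge structures `φ_t : H^{2n−j}(Z) → Hⁱ(Y)(c − n)`, `t ↦ φ_t` injective) it reads, in the language of Hodge morphisms: every window `φ` is induced by a rational class of the form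
`crossMap t` (a class of the single Künneth piece) with `crossMap t ⊗ 1` algebraic (§2) — necessarily `t = t_φ`.  A SINGLE `φ` being induced by SOME algebraic class is NOT enough in general (the other
Künneth components of that class need not be algebraic); the two correct single-degree formulations are the isolated one of this file and the joint one of g31-#10.

WHAT IS PROVED (complex orientations in §2–§3).
* §1 **`BettiUniverse.hodgeConjectureFor_tensor_iff_forall_kunneth_pieces_window_algebraic`** — given `HC(Y)`, `HC(Z)`: `HC(Y × Z)` ⟺ for all window pieces (`2 ≤ c`) and all their Hodge classes
  `t`, `crossMap t ⊗ 1` is algebraic.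
* §2 **`BettiUniverse.hodgeConjectureFor_tensor_iff_forall_hom_window_exists_crossMap_algebraic`** — given `HC(Y)`, `HC(Z)`: `HC(Y × Z)` ⟺ every window morphism `φ : H^{2n−j}(Z) → Hⁱ(Y)(c − n)` is
  induced by some `crossMap t`, `t ∈ Hⁱ(Y;ℚ) ⊗ Hʲ(Z;ℚ)`, with `crossMap t ⊗ 1` algebraic.
* §3 **`BettiUniverse.hodgeConjectureFor_tensor_iff_factors_and_forall_hom_window_exists_crossMap_algebraic`** — `HC(Y × Z)` ⟺ `HC(Y) ∧ HC(Z) ∧` the criterion of §2 (the projections are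
  surjective: tree `hodgeConjectureFor_of_tensor_left/right`).

THE PRINTS.  C. Voisin (2002) [VoisinHodgeI2002] §6.2.3 Thm. 6.25, Rem. 6.27; §7.3.1 Def. 7.22, Lemma 7.23; §7.3.2 Lemma 7.28, Rem. 7.29; §11.3.1 Thm. 11.30; §11.3.3 Thm. 11.38–11.40, Lemma 11.41 and
pp. 285–287.  C. Voisin (2003) [VoisinHodgeII2003] §9.2.4 Prop. 9.20.  C. Voisin (2025) [Voisin2025] §3.2.1 (12)–(14), Prop. 3.8, Cor. 3.9.  D. Arapura (2006) [Arapura2006] §4 Lemma 4.2, §1 Cor. 1.2.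
P. Deligne (2000/2006) [Deligne2000] §1.

THE OBJECTS (all the tree's).  `BettiUniverse.kunnethSummand`, `BettiUniverse.crossMap`, `BettiUniverse.hodge`, `corrAction complexOrientationFamily`, `HodgeStructure.Hom`, `tateTwist` (`r : ℤ`), `cast`,
`hodgeClasses`, `ofRatClass`, `algebraicClasses`, `HodgeConjectureFor`; the tree's `BettiUniverse.hodgeConjectureFor_tensor_of_kunneth_pieces_pos_le`, `BettiUniverse.crossMap_mem_hodgeClasses`, g31-#2
`BettiUniverse.exists_hom_tateTwist_int_of_mem_hodgeClasses_kunnethSummand`, `BettiUniverse.exists_mem_hodgeClasses_corrAction_crossMap_eq_ofRatClass_hom_int`, g30 `BettiUniverse.corrAction_crossMap_injective`,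
`BettiUniverse.span_range_ofRatClass_eq_top`, `hodgeConjectureFor_of_tensor_left/right`, `IsSmoothProjective.tensor_holds`.

DEVIATIONS / SCOPE.  Complex orientations in §2–§3.  No definitions.

## References
* [VoisinHodgeI2002] C. Voisin, *Hodge Theory and Complex Algebraic Geometry I* (2002) — §6.2.3 Thm. 6.25, Rem. 6.27; §7.3.1 Def. 7.22, Lemma 7.23; §7.3.2 Lemma 7.28, Rem. 7.29; §11.3.1 Thm. 11.30; §11.3.3 Thm. 11.38–11.40, Lemma 11.41, pp. 285–287.
* [VoisinHodgeII2003] C. Voisin, *Hodge Theory and Complex Algebraic Geometry II* (2003) — §9.2.4 Prop. 9.20.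
* [Voisin2025] C. Voisin, *Cycle classes on algebraic varieties* (2025) — §3.2.1 (12)–(14), Prop. 3.8, Cor. 3.9.
* [Arapura2006] D. Arapura, *Motivation for Hodge cycles* (2006) — §4 Lemma 4.2, §1 Cor. 1.2.
* [Deligne2000] P. Deligne, *The Hodge conjecture* (Clay problem description) — §1.

## Provenance
Lane `lit-hodgefound` (Hodge path, Track 2), prover seat `lit-hodgefound-p29` (generation 31), self-proposed row g31-#11 (two factors of arbitrary dimensions: the isolated window criterion — per piece
and per Hodge morphism).
-/

noncomputable section

open scoped TensorProduct
open CategoryTheory MonoidalCategory CartesianMonoidalCategory Module Finset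
open Literature.AlgebraicTopology.SingularHomology
open Literature.Geometry.Kaehler

namespace Literature.AlgebraicGeometry.HodgeTheory

open Literature.AlgebraicGeometry.Motives
open Literature.AlgebraicGeometry.Motives.HodgeStructure

variable {m n d : ℕ} {Y Z : SchemeOver ℂ}

variable [HodgeTensorFacts.{0, 0}]

/-! ### §1 The per-piece window criterion is an equivalence -/

/-- **Given `HC(Y)` and `HC(Z)`: `HC(Y × Z)` ⟺ for every window piece `Hⁱ(Y) ⊗ Hʲ(Z) ⊂ H^{2c}(Y × Z)`, `1 ≤ i ≤ m`, `1 ≤ j ≤ n`, `2 ≤ c`, and every Hodge class `t` of it, `crossMap t ⊗ 1` is algebraic**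
(«⇐» is the tree's assembly `…_of_kunneth_pieces_pos_le`: the other pieces are free by `HC(Z)`, `HC(Y)`, hard Lefschetz and Lefschetz `(1,1)`; «⇒»: `crossMap t` is a Hodge class of `H^{2c}(Y × Z)`,
Thm. 11.40). [cite: VoisinHodgeI2002, §11.3.3 Thm. 11.38, Thm. 11.40, Lemma 11.41, p. 287, §11.3.1 Thm. 11.30, §6.2.3 Thm. 6.25] [cite: VoisinHodgeII2003, §9.2.4 Prop. 9.20] [cite: Deligne2000, §1] -/
theorem BettiUniverse.hodgeConjectureFor_tensor_iff_forall_kunneth_pieces_window_algebraic (hHD : exists_isReal_hodgeModel) (hY : IsSmoothProjective m Y) (hZ : IsSmoothProjective n Z)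
    (hYZ : IsSmoothProjective d (Y ⊗ Z)) (hHCY : HodgeConjectureFor m Y) (hHCZ : HodgeConjectureFor n Z) :
    HodgeConjectureFor d (Y ⊗ Z) ↔
      ∀ (c i j : ℕ) (hij : i + j = 2 * c), 1 ≤ i → i ≤ m → 1 ≤ j → j ≤ n → 2 ≤ c →
        ∀ t ∈ (BettiUniverse.kunnethSummand hHD hY hZ (2 * c) ⟨(i, j), HasAntidiagonal.mem_antidiagonal.2 hij⟩).hodgeClasses c,
          ofRatClass (ComplexPoints (Y ⊗ Z)) (2 * c) (BettiUniverse.crossMap Y Z hij t) ∈ algebraicClasses (Y ⊗ Z) c := by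
  refine ⟨fun hHC c i j hij _ _ _ _ _ t ht ↦ ?_, BettiUniverse.hodgeConjectureFor_tensor_of_kunneth_pieces_pos_le hHD hY hZ hYZ hHCY hHCZ⟩
  exact hHC.2 c _ (isRationalClass_ofRatClass _) ((BettiUniverse.mem_hodgeClasses_hodge_iff_isOfHodgeType hHD hYZ c _).1
    (BettiUniverse.crossMap_mem_hodgeClasses hHD hodgePQ_independent_of_hodgeModel_holds hY hZ hYZ hij c ht))

/-! ### §2 The isolated window criterion on morphisms of Hodge structures -/

/-- **Given `HC(Y)` and `HC(Z)`: `HC(Y × Z)` ⟺ for every window piece (`2 ≤ c`, `1 ≤ i ≤ m`, `1 ≤ j ≤ n`, `i + j = 2c`, `a + j = 2n`, `n + r = c`) every morphism of `ℚ`-Hodge structures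
`φ : Hᵃ(Z) → Hⁱ(Y)(r)` is induced, in its action `Hᵃ(Z;ℂ) → Hⁱ(Y;ℂ)`, by a class `crossMap t`, `t ∈ Hⁱ(Y;ℚ) ⊗ Hʲ(Z;ℚ)`, with `crossMap t ⊗ 1` algebraic** (complex orientations).  «⇒»: `t = t_φ`, the Hodge
class of the piece with `φ_{t_φ} = φ` (Lemma 11.41 with integer twists), and §1.  «⇐»: for a Hodge class `u` of a window piece, the class `t` provided for `φ_u` acts on `Hᵃ(Z;ℂ)` as `u` does, so `t = u`
(the piece acts faithfully) and `crossMap u ⊗ 1` is algebraic; §1. [cite: VoisinHodgeI2002, §7.3.1 Def. 7.22, §7.3.2, §11.3.3 Thm. 11.38–11.40, Lemma 11.41 and pp. 285–287, §6.2.3 Thm. 6.25, §11.3.1 Thm. 11.30]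
[cite: Voisin2025, §3.2.1 (12)–(14), Prop. 3.8 and Cor. 3.9] [cite: Deligne2000, §1] -/
theorem BettiUniverse.hodgeConjectureFor_tensor_iff_forall_hom_window_exists_crossMap_algebraic (hHD : exists_isReal_hodgeModel) (hY : IsSmoothProjective m Y) (hZ : IsSmoothProjective n Z)
    (hYZ : IsSmoothProjective d (Y ⊗ Z)) (hHCY : HodgeConjectureFor m Y) (hHCZ : HodgeConjectureFor n Z) :
    HodgeConjectureFor d (Y ⊗ Z) ↔
      ∀ (c i j a : ℕ) (r : ℤ) (_hc : 2 ≤ c) (_hi : 1 ≤ i) (_him : i ≤ m) (_hj : 1 ≤ j) (_hjn : j ≤ n) (hij : i + j = 2 * c) (_haj : a + j = 2 * n) (hab : a + 2 * c = i + 2 * n)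
        (_hr : ((n : ℕ) : ℤ) + r = ((c : ℕ) : ℤ)) (hw : ((i : ℕ) : ℤ) - 2 * r = ((a : ℕ) : ℤ))
        (φ : HodgeStructure.Hom (BettiUniverse.hodge hHD hZ a) (((BettiUniverse.hodge hHD hY i).tateTwist r).cast hw)),
        ∃ t : bettiCohomology Y i ⊗[ℚ] bettiCohomology Z j, ofRatClass (ComplexPoints (Y ⊗ Z)) (2 * c) (BettiUniverse.crossMap Y Z hij t) ∈ algebraicClasses (Y ⊗ Z) c ∧
          ∀ v, corrAction complexOrientationFamily hY hZ hab (ofRatClass (ComplexPoints (Y ⊗ Z)) (2 * c) (BettiUniverse.crossMap Y Z hij t)) (ofRatClass (ComplexPoints Z) a v) =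
            ofRatClass (ComplexPoints Y) i (φ.toLinearMap v) := by
  rw [BettiUniverse.hodgeConjectureFor_tensor_iff_forall_kunneth_pieces_window_algebraic hHD hY hZ hYZ hHCY hHCZ]
  constructor
  · intro h c i j a r hc hi him hj hjn hij haj hab hr hw φ
    obtain ⟨t, ht, hφ⟩ := BettiUniverse.exists_mem_hodgeClasses_corrAction_crossMap_eq_ofRatClass_hom_int hHD hY hZ hij haj hab hr hw φ
    exact ⟨t, h c i j hij hi him hj hjn hc t ht, hφ⟩
  · intro h c i j hij hi him hj hjn hc u hu
    have haj : (2 * n - j) + j = 2 * n := by omega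
    have hab : (2 * n - j) + 2 * c = i + 2 * n := by omega
    have hr : ((n : ℕ) : ℤ) + (((c : ℕ) : ℤ) - ((n : ℕ) : ℤ)) = ((c : ℕ) : ℤ) := by omega
    have hw : ((i : ℕ) : ℤ) - 2 * (((c : ℕ) : ℤ) - ((n : ℕ) : ℤ)) = (((2 * n - j : ℕ)) : ℤ) := by omega
    -- the morphism `φ_u` of the Hodge class `u` (g31-#2 §1) and the class `t` the criterion provides for it
    obtain ⟨φ, hφ⟩ := BettiUniverse.exists_hom_tateTwist_int_of_mem_hodgeClasses_kunnethSummand hHD hY hZ hij hab hr hw hu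
    obtain ⟨t, ht, htφ⟩ := h c i j (2 * n - j) (((c : ℕ) : ℤ) - ((n : ℕ) : ℤ)) hc hi him hj hjn hij haj hab hr hw φ
    -- `t` and `u` act alike on `H^{2n−j}(Z;ℂ)`, hence `t = u`
    have e : t = u := BettiUniverse.corrAction_crossMap_injective complexOrientationFamily hY hZ hij haj hab
      (LinearMap.ext_on_range (BettiUniverse.span_range_ofRatClass_eq_top hZ (2 * n - j)) fun v ↦ by rw [htφ v, hφ v])
    exact e ▸ ht

/-! ### §3 With the factors' conjectures on the right-hand side -/

/-- **`HC(Y × Z)` ⟺ `HC(Y)`, `HC(Z)` and the isolated window criterion of §2** (the projections of `Y × Z` are surjective, so `HC(Y × Z) ⟹ HC(Y), HC(Z)`: Voisin I Lemma 7.28, Arapura Lemma 4.2).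
[cite: VoisinHodgeI2002, §7.3.2 Lemma 7.28 and Remark 7.29, §11.3.3 Thm. 11.38–11.40, Lemma 11.41 and pp. 285–287] [cite: Arapura2006, §4 Lemma 4.2 (clause HC) and §1 Cor. 1.2] [cite: Voisin2025, §3.2.1 (12)–(14), Prop. 3.8 and Cor. 3.9]
[cite: Deligne2000, §1] -/
theorem BettiUniverse.hodgeConjectureFor_tensor_iff_factors_and_forall_hom_window_exists_crossMap_algebraic (hHD : exists_isReal_hodgeModel) (hY : IsSmoothProjective m Y)
    (hZ : IsSmoothProjective n Z) :
    HodgeConjectureFor (m + n) (Y ⊗ Z) ↔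
      HodgeConjectureFor m Y ∧ HodgeConjectureFor n Z ∧
        ∀ (c i j a : ℕ) (r : ℤ) (_hc : 2 ≤ c) (_hi : 1 ≤ i) (_him : i ≤ m) (_hj : 1 ≤ j) (_hjn : j ≤ n) (hij : i + j = 2 * c) (_haj : a + j = 2 * n) (hab : a + 2 * c = i + 2 * n)
          (_hr : ((n : ℕ) : ℤ) + r = ((c : ℕ) : ℤ)) (hw : ((i : ℕ) : ℤ) - 2 * r = ((a : ℕ) : ℤ))
          (φ : HodgeStructure.Hom (BettiUniverse.hodge hHD hZ a) (((BettiUniverse.hodge hHD hY i).tateTwist r).cast hw)),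
          ∃ t : bettiCohomology Y i ⊗[ℚ] bettiCohomology Z j, ofRatClass (ComplexPoints (Y ⊗ Z)) (2 * c) (BettiUniverse.crossMap Y Z hij t) ∈ algebraicClasses (Y ⊗ Z) c ∧
            ∀ v, corrAction complexOrientationFamily hY hZ hab (ofRatClass (ComplexPoints (Y ⊗ Z)) (2 * c) (BettiUniverse.crossMap Y Z hij t)) (ofRatClass (ComplexPoints Z) a v) =
              ofRatClass (ComplexPoints Y) i (φ.toLinearMap v) := by
  refine ⟨fun h ↦ ?_, fun h ↦ (BettiUniverse.hodgeConjectureFor_tensor_iff_forall_hom_window_exists_crossMap_algebraic hHD hY hZ (hY.tensor_holds hZ) h.1 h.2.1).2 h.2.2⟩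
  have hHCY : HodgeConjectureFor m Y := hodgeConjectureFor_of_tensor_left hY hZ h
  have hHCZ : HodgeConjectureFor n Z := hodgeConjectureFor_of_tensor_right hY hZ h
  exact ⟨hHCY, hHCZ, (BettiUniverse.hodgeConjectureFor_tensor_iff_forall_hom_window_exists_crossMap_algebraic hHD hY hZ (hY.tensor_holds hZ) hHCY hHCZ).1 h⟩

end Literature.AlgebraicGeometry.HodgeTheory

end
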